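import Mathlib.NumberTheory.Cyclotomic.Basic
import Literature.NumberTheory.EllipticCurves.IwasawaSelmerEigen
import Literature.NumberTheory.EllipticCurves.SelmerPInftyRestriction
import Literature.NumberTheory.EllipticCurves.Wuthrich2014.ReducibleDivisibilityCyclotomicThree
import Literature.NumberTheory.EllipticCurves.PAdicLFunctionMinusMult
import Literature.NumberTheory.EllipticCurves.PAdicLFunctionPlusMult
import Literature.NumberTheory.EllipticCurves.PAdicLFunctionBranch
import HarnessLib

/-!
# Kato's divisibility at an odd prime `p` of SEMISTABLE reduction for curves with SURJECTIVE `ρ_{E,p^∞}`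
# (Kato 2004 Thm. 17.4 (3) at a good ordinary `p`; Wuthrich 2014 Thm. 3 / Cor. 19, "proven by Kato", at
# a multiplicative `p`) — the SINGLE component `i = (p−1)/2`:
# `char_{Λ(Γ)}(e_{(p−1)/2} X(E/ℚ(ζ_{p^∞}))) ∋ u · L_p(E, ω^{(p−1)/2}, T)`, read on the
# `χ_{ℚ(√p*)}`-eigenspace of `Sel_{p^∞}(E/ℚ(μ_{p^∞}))` in the subgroup model over `Γ_ℚ` (named fact;
# the general-`p` parent of A123 and of the good-ordinary component reading A124)

Sources, as PUBLISHED. (a) Good ordinary `p`: K. Kato, *`p`-adic Hodge theory and values of zeta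
functions of modular forms*, Astérisque 295 (2004) [Kato2004Asterisque], **Theorem 17.4** (p. 273):
"Assume `f` has good ordinary reduction at `λ`. Let `T` be a `Gal(ℚ̄/ℚ)`-stable `O_λ`-lattice of
`V_{F_λ}(f)`. (1) `X(T)` is a torsion `Λ`-module. […] (3) […] assume that both `ω` and `γ` are good
[…]. Assume further `p ≠ 2` and that the condition 12.5.2 in 12.5 (4) is satisfied. Then
`L_{p-adic,α,ω,γ}(f)` belongs to `Λ` and `length_{Λ_𝔭}(X(T)_𝔭) ≤ ord_𝔭(L_{p-adic,α,ω,γ}(f))` for any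
prime ideal `𝔭` of `Λ` of height one", with §17.3 (p. 273: `X(T)` the dual of
`Sel_∞(T) = lim_n Sel(ℚ(ζ_{p^n}), T(r))(−r)` over `Λ = O_λ⟦G_∞⟧`), §12.1 (p. 219), (12.5.2) (p. 222:
"the image of `Gal(ℚ̄/ℚ(ζ_{p^∞})) → GL_{O_λ}(T)` contains `SL₂(ℤ_p)`"), §17.5 (p. 274), Thm. 16.2
(p. 269). (b) Multiplicative `p`: C. Wuthrich, *On the integrality of modular symbols and Kato's Euler system
for elliptic curves*, Doc. Math. 19 (2014) 381–402 [Wuthrich2014]. §1 (p. 383): "Another consequence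
of theorem 4 concerns the main conjecture in Iwasawa theory for elliptic curves. **We formulate it here
for the full cyclotomic `ℤ_p^×`-extension.** Theorem 3. Let `E` be an elliptic curve and `p` an odd
prime of semi-stable reduction. Assume that `E[p]` is reducible as a Galois module over `ℚ`. Then the
characteristic series of the dual of the Selmer group over the cyclotomic extension [divides the ideal
generated by `L_p(E)`]. […] In the case when `E` has split multiplicative reduction, one can strengthen
this a bit, see theorem 16. **This theorem was proven by Kato in [Kato 2004] in the case that the
representation on the Tate module was surjective.**"; §6 Cor. 19 (p. 398) and its proof (p. 399): "If
`E/ℚ` is a semi-stable elliptic curve and `p` an odd prime, then `char_Λ X(E)`, or `I char_Λ X(E)` in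
the split multiplicative case, divides the ideal generated by `L_p(E)`. Proof. By a theorem of Serre
[…] the image of `ρ̄_p` is either the whole of `GL₂(𝔽_p)` or it is contained in a Borel subgroup. In
the latter case the representation `ρ̄_p` is reducible and in the first case the representation
`ρ_p : G_ℚ → Aut(T_p E)` is surjective by another result of Serre unless `p = 3`. Finally for `p = 3`
we use the following lemma to exclude that `ρ_p` is not surjective." — the FIRST CASE of the printed
proof derives the conclusion from the surjectivity of `ρ_p` on `T_pE` alone, at every odd `p`; §3
(p. 390): "we split `M` up into the eigenspaces `M = ⊕_{i=0}^{p−2} M_i` where `Δ` acts on `M_i` […] by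
the `i`-th power of the Teichmüller character"; §4 (p. 396): `char_Λ` = product over height-one primes;
§5 (p. 397): `X(E)` = the dual of `lim_n Sel(E/ℚ(ζ_{p^n}))`, "`Λ`-torsion … in general in our
situation"; §3.2 (p. 394); Cor. 18 (p. 398): `L_p(E) ∈ Λ` for semi-stable `p > 2`. Torsion over the
abelian base `ℚ(ζ_p)` also: Greenberg, LNM 1716 Thm. 1.5 (PDF p. 61); eigenspace descent display:
LNM 1716 §5 p. 143. Behind the attribution: Kato, Astérisque 295 (2004) Thm. 12.5 (4) under (12.5.2)
(image of `Gal(ℚ̄/ℚ(ζ_{p^∞}))` contains `SL₂(ℤ_p)`, implied by surjectivity of `ρ_{E,p^∞}`).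

ONE NAMED FACT (`def … : Prop`, nothing asserted, D-0014/D-0026): Kato's divisibility over the full
`ℤ_p^×`-tower for a curve SEMISTABLE at the odd prime `p` with `ρ_{E,p^∞}` onto — all three local
types: good ordinary (Kato Thm. 17.4 (3); two-term measure, unit root `α`), split multiplicative
(one-term measure, `a = +1`), non-split multiplicative (`a = −1`) (both: "Kato's theorem as attributed in
Wuthrich Thm. 3 / Cor. 19, first case of the proof") — READ ON THE SINGLE EIGENCOMPONENT
`i = m := (p−1)/2`, stated, as the `p = 3` member `kato_minusEigenCharIdeal_dvd_cyclotomicThree_of_surjective`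
(A123), in the Literature eigen-Selmer vocabulary `WeierstrassCurve.EigenSelmerDualData`. It is the
general-`p` PARENT of A123 (`p = 3`, `F = K = ℚ(ζ₃)`) and of the good-ordinary component reading
`Kato2004.charIdeal_dvd_padicLFunctionBranch_component_of_surjective` (A124, fields inlined) — both
derivable from it in the kernel — and the component form of the all-branches PRODUCT readings
A118/A128/A129, which is NOT a kernel consequence of them (a product membership does not split back
into its factors); the big-image twin of `thm16_halfEigenCharIdeal_dvd_cyclotomicPrime` (same module
shape and conclusion). Literature-seat ruling C169 (2026-08-20): filed as the LAST big-image member of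
the Wuthrich-16 / Kato-17.4 reading family; flags `Wu14-surj-attribution`, `Kato-17.4-pgen-branch-split`
(ONE component).

## The reading (identical to the reducible twin; only the source sentences and the image hypothesis differ)

`Λ = ℤ_p⟦G⟧ = ⊕_{i=0}^{p−2} Λ(Γ)e_i` (`G = Δ × Γ`, `#Δ = p − 1` prime to `p`); the height-one primes
of `Λ` are those of the factors `Λ(Γ)`, so "`char_Λ X(E)` [or `I·char_Λ X(E)`] divides `(L_p(E))`"
SAYS `e_iL_p(E) ∈ char_{Λ(Γ)}(e_iX)` for every `i`; THIS FACT is `i = m = (p−1)/2 ≠ 0`; in the split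
case `e_m ∈ I` (the augmentation kills every `e_i`, `i ≠ 0`), `e_mI = e_mΛ`, so NO extra factor.
`e_mL_p(E) = L_p(E, ω^m, T)`, the `ω^m`-branch (MTT §I.13; Kato Thm. 16.2 with Néron `ω`, good `γ`)
of the Néron-normalised measure: the TWO-TERM measure with the unit root `α` at a good ordinary `p`
(tree `padicLFunctionBranch f α m` / `padicLFunctionMinusBranch f α m`), the ONE-TERM measure at a
multiplicative `p` (`ε(p) = 0`, §I.10; `a = a_p = +1` split / `−1` non-split; tree
`padicLFunctionPlusBranchMult f a m` / `padicLFunctionMinusBranchMult f a m`): PLUS modular symbols if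
`m` is even (`p ≡ 1 (mod 4)`), MINUS symbols if `m` is odd (`p ≡ 3 (mod 4)`) — `m` even iff
`Even (p / 2)`. For `E/ℚ`: `F_λ = ℚ_p`, `O_λ = ℤ_p`, `T = T_pE(−1)`, `r = 1`,
`Sel(ℚ(ζ_{p^n}), T(1)) = Sel_{p^∞}(E/ℚ(ζ_{p^n}))` (Kato §14.1), so Kato's `X(T)` IS Wuthrich's `X(E)`.
Field and module, exactly as in the reducible twin: `ℚ(ζ_{p^∞}) = F·ℚ_∞`, `F = ℚ(ζ_p)`;
`Gal(ℚ̄/ℚ(ζ_{p^∞})) = ker κ ⊓ galRange K ⊓ galRange F =: H` (`κ` THE cyclotomic `ℤ_p`-extension of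
`ℚ`; `K = ℚ(√p*) ⊂ F` the field of the quadratic character `ω^m`, so the `K`-factor is redundant and
kept for the cell's shape), `H' := ker κ = Gal(ℚ̄/ℚ_∞)` acting by `g_*`, `ω^m(g) = ±1` according as
`g ∈ galRange K`; `M_m = eigenSelmerGroupOver V p H H' ω^m`, `e_mX = X_m = Hom(M_m, ℚ_p/ℤ_p)` as a
`Λ(Γ)`-module with `T = γ − 1`, `γ ∈ Gal(ℚ̄/F)` lifting `χ_p(γ) = 1 + p` (`IsCyclotomicVariable p γ`,
`κ.IsTopGenerator γ`) — a datum `D : V.EigenSelmerDualData p H H' ω^m γ`. "Surjective on the Tate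
module" / (12.5.2) is transcribed, as in every tree transcription (`kato_divisibility` clause 3,
p181258, A123), by "`ρ̄_{E,p^n}` onto for every `n`" (`∀ n, HasSurjectiveModNGaloisRep (p^n)`).
Periods: `ϖ·Ω_E = Ω⁺_f` (`m` even) / `ϖ·|Ω⁻(E)| = Ω⁻_f` (`m` odd); units (signs, `c_∞`, powers of `2`)
in `u ∈ ℤ_pˣ`.

Hypotheses transcribed: `E = V` globally minimal over `ℚ`; `p ≠ 2`; SEMISTABLE at `p` as the
disjunction of the three local types each paired with ITS branch `B` (good ordinary — Kato 17.1 (i):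
`p ∤ N`, `a_p ∈ O_λ^×` — `IsOrdinaryAt V p` with the two-term branch, `α = unitRoot V p`; split with
the one-term branch, `a = 1`; non-split with `a = −1`; PLUS/MINUS by the parity of `m`);
`ρ̄_{E,p^n}` onto for all `n`; `K` of degree `2`
with `θ² = p*` and `F = ℚ(ζ_p)` (both `galRange` normal — automatic, carried as instances); `κ`
cyclotomic with topological generator `γ ∈ galRange K ⊓ galRange F` matching the cyclotomic variable;
`f` the newform of `E`; `D`; `ϖ` with the period relation of the parity of `m`. Conclusion: `e_mX` is
`Λ(Γ)`-torsion (direct summand of the torsion `X(E)`: Kato 17.4 (1) / §5 p. 397 / Greenberg Thm. 1.5)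
and `u · ϖ · B = ι g` for some `g ∈ char_{Λ(Γ)}(e_mX)`, `u ∈ ℤ_pˣ`. What is NOT here: the other
components, (12.5.2) in its printed generality, global semistability (Cor. 19's own hypothesis —
replaced, as in p181258 and A123, by the surjectivity it is used to produce), `p = 2`, any proof. No
`_holds` expected. OVERLAP (by design, ruling C169): A123 (`p = 3`) and A124 (good ordinary, inline
datum) are the special cases `F = K = ℚ(ζ₃)` resp. first disjunct; kernel derivations of both from this
fact are filed separately (debt-free corollaries).
-- TODO(general form): for every `i mod p − 1` (with `e₀I = (T)` in the split case), which needs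
-- `ℤ_p`-valued characters `ω^i` on the eigen-subgroup; Kato 17.4 (3) for lattices in `V_{F_λ}(f)` of
-- any ordinary newform under (12.5.2) as printed.

Consumer: the BSD rank-≤1 residual cell (`b2b-bsdres`), sub-cell additive-p1 (X4(M): additive,
potentially MULTIPLICATIVE `p`, `E[p]` irreducible with `ρ̄_{E,p}` onto — `ρ_{E♭,p^∞}` onto for the
multiplicative twist `E♭` by Serre / Wuthrich Lemma 20): with the kernel transport [C]
(`AdditivePotMult/TwistDescent`, `ChiEigenSelmerDual`, additive-p2's `Additive/ChiEigenPrimeToPDescent*`)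
and the `T = 0` value of `B_m` this fact makes `ChiBranchLeadingTerm[Odd]BigImageAt W p` a theorem for
every `W` potentially multiplicative at `p`, hence the rank-`0` upper half `ord_p #Ш(E) ≤ ord_p #Ш_an(E)`
for every X4(M) ∧ surj(p) curve at EVERY odd `p` from published theorems + kernel glue (at `p = 3`
already by A123); additive-p2's (G-ord) twins use the good-ordinary disjunct. HONEST FRAMING: the cell deletes COMBINATION-SHAPED classes from published theorems
and TYPES the construction-shaped remainder; labels of X3/X4 unchanged by this file; nothing here is
"finishing BSD".
-/

set_option autoImplicit false

noncomputable section

open scoped Classical MatrixGroups ModularForm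

open CongruenceSubgroup WeierstrassCurve Literature.NumberTheory.EllipticCurves
  Literature.NumberTheory.EllipticCurves.ModularForms
  Literature.NumberTheory.GaloisRepresentations

namespace Literature.NumberTheory.EllipticCurves.Wuthrich2014

/-- **Kato's divisibility at an odd prime `p` of SEMISTABLE reduction under surjective `ρ_{E,p^∞}` — the
component `m = (p−1)/2`: `char_{Λ(Γ)}(e_m X(E/ℚ(ζ_{p^∞}))) ∋ u · L_p(E, ω^m, T)`** (Kato, Astérisque
295, Thm. 17.4 (1), (3), p. 273, at a GOOD ORDINARY `p`: "`X(T)` is a torsion `Λ`-module […]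
`length_{Λ_𝔭}(X(T)_𝔭) ≤ ord_𝔭(L_{p-adic,α,ω,γ}(f))` for any prime ideal `𝔭` of `Λ` of height one" under
(12.5.2), `Λ = O_λ⟦Gal(ℚ(ζ_{p^∞})/ℚ)⟧`; Wuthrich, Doc. Math. 19 (2014), §1 Thm. 3 with its attribution
sentence, p. 383, and Cor. 19 with the first case of its proof, pp. 398–399, at a MULTIPLICATIVE `p`: "We formulate it here for the full cyclotomic `ℤ_p^×`-extension. Theorem 3.
Let `E` be an elliptic curve and `p` an odd prime of semi-stable reduction. […] the characteristic
series of the dual of the Selmer group over the cyclotomic extension [divides the ideal generated by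
`L_p(E)`] […] This theorem was proven by Kato in the case that the representation on the Tate module
was surjective"; Cor. 19: "`char_Λ X(E)`, or `I char_Λ X(E)` in the split multiplicative case, divides
the ideal generated by `L_p(E)`. Proof. […] in the first case the representation
`ρ_p : G_ℚ → Aut(T_p E)` is surjective […]") — `Λ = ℤ_p⟦Gal(ℚ(ζ_{p^∞})/ℚ)⟧`, `X(E)` the dual of
`lim_n Sel(E/ℚ(ζ_{p^n}))` (§5 p. 397; `Λ`-torsion loc. cit. / Greenberg LNM 1716 Thm. 1.5), `char_Λ`
the product over height-one primes (§4 p. 396), `L_p(E) ∈ Λ` (Cor. 18) the Néron-normalised MTT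
measure (two-term at good ordinary `p`, one-term `ε(p) = 0` with `a = a_p = ±1` at multiplicative
`p`), `I` the augmentation ideal; §3 (p. 390): "we split `M` up into the eigenspaces
`M = ⊕_{i=0}^{p−2} M_i` where `Δ` acts on `M_i` […] by the `i`-th power of the Teichmüller character".
Since `Λ = ⊕_i Λ(Γ)e_i` (`p ∤ #Δ`) and the
height-one primes are those of the factors, the printed divisibility says `e_iL_p(E) ∈ char(e_iX)`
for every `i`; THIS FACT IS THE COMPONENT `i = m = (p−1)/2`: `L_p(E, ω^m, T) ∈ char_{Λ(Γ)}(e_mX)`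
(`e_m ∈ I`, `e_mI = e_mΛ`: no extra factor in the split case), `L_p(E, ω^m, T)` the `ω^m`-branch
(MTT §I.13) of the two-term measure with the unit root (good ordinary) resp. the one-term measure with
`a = a_p = ±1` (multiplicative) — on `[·]⁺` if `m` is even, on `[·]⁻` if `m` is odd. Field and
module: `ℚ(ζ_{p^∞}) = F·ℚ_∞`, `F = ℚ(ζ_p)`; `ω^m` = the quadratic character of `Δ`,
cutting out `K = ℚ(√p*) ⊂ F`; in the tree's subgroup model `H = ker κ ⊓ galRange K ⊓ galRange F =
Gal(ℚ̄/ℚ(ζ_{p^∞}))` (`κ` the cyclotomic `ℤ_p`-extension of `ℚ`), `H' = ker κ` acts by `g_*`,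
`ω^m(g) = ±1` according as `g ∈ galRange K`; `M_m = eigenSelmerGroupOver V p H H' ω^m` and
`e_mX = X_m` is its Pontryagin dual with `T = γ − 1`, `γ ∈ Gal(ℚ̄/F)` (hence `∈ Gal(ℚ̄/K)`) lifting
`χ_p(γ) = 1 + p` — a datum `D : V.EigenSelmerDualData p H H' ω^m γ` (file `IwasawaSelmerEigen`).
"Surjective on the Tate module" / Kato (12.5.2) spelled `∀ n, Surj(p^n)` (as in `kato_divisibility`
clause 3 and A123). Periods: `ϖ·Ω_E = Ω⁺_f` (`m` even) / `ϖ·|Ω⁻(E)| = Ω⁻_f` (`m` odd); units in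
`u ∈ ℤ_pˣ`. Hypotheses: `V` globally minimal; `p ≠ 2`; semistable at `p` as the disjunction (good
ordinary, `B` = two-term branch with `α = unitRoot V p`) ∨ (split, `B` = one-term branch, `a = 1`) ∨
(non-split multiplicative, `a = −1`), PLUS/MINUS by `Even (p/2)`; `ρ̄_{V,p^n}` onto for all `n`; `K`
(degree `2`, `θ² = p*`), `F`, `κ`, `γ`, `f`, `D`, `ϖ` as displayed. Conclusion:
`Module.IsTorsion Λ D.X ∧ ∃ g ∈ D.charIdeal, ∃ u, ι g = C(u ϖ) · B`. The general-`p` parent of A123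
(`p = 3`) and of the good-ordinary component reading A124 (both derivable from it), the `ω^m`-component
of the product readings A118/A128/A129 (not a kernel consequence of them), the big-image twin of
`thm16_halfEigenCharIdeal_dvd_cyclotomicPrime`; literature-seat ruling C169. READING FLAGS (register
history; doc-only, no statement change): `Kato-17.4-pgen-branch-split` STRUCK by referee C R268 (the
(12.5.2) bridge is the kernel theorem `Kato2004.imageContainsSL2_of_forall_hasSurjectiveModNGaloisRep`);
`Wu14-surj-attribution` PRICED strike-grade and STRUCK by referee A ROUND 294 (2026-08-26) under (β′):
at a MULTIPLICATIVE `p` the warrant is NOT «Kato Thm. 17.4» (printed for good ordinary `p` only,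
17.1 (i) p. 272) but the cross-paper READING-OF-PROOF of bsd-addord's D-AUDIT-A136 ADDENDUM-1 §B (graded
PASS by referee C R280, re-walked page by page by referee A R294.2): Wuthrich's printed proof of Thm. 16
(p. 398) with Prop. 15 (p. 397), Lemmas 11–12 (pp. 394–395) and §3.2 (p. 394: the Coleman map at
non-split multiplicative `p` by the proof of Kato Prop. 17.11, at split `p` by Kobayashi Thm. 4.1),
the integrality step Kato Thm. 12.4 (3) (p. 221: `p ≠ 2`, `T/𝔪T` irreducible ⇒ `H¹(T)` free of
rank one) and the surjective substitute for Prop. 15 = Kato Thm. 12.5 (4) under (12.5.2) (p. 222),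
proved at 13.14 (p. 234) from Thm. 13.4 (3) (p. 226) «for any prime ideal 𝔭 of Λ of height one» — both
non-verbatim moves signposted by Wuthrich himself (p. 390; p. 397 «the Euler system argument gives us
only a divisibility of the form char_Λ(Y(E)) divides J·ind_Λ(p^k z) … see Theorem 13.4 in [10]»), the
one dropped standing hypothesis (reducibility of `E[p]`) being consumed only by his Lemma 14 (p. 396),
which this chain does not use; every step a numbered refereed statement used inside its printed
hypotheses, the composite WEAKER than what the printed proofs prove. Named fact; nothing asserted.
[cite: Kato2004Asterisque, Thm. 17.4 (1), (3) (p. 273) with §17.3 (p. 273) and Thm. 17.1 (i) (p. 272) — the good ordinary disjunct; Thm. 12.4 (3) (p. 221), Thm. 12.5 (4) with (12.5.2) (p. 222), Prop. 12.6, Thm. 13.4 (3) (p. 226), 13.14 (p. 234), Thm. 16.6, Rem. 16.5 (2), Prop. 17.11, §17.5 (p. 274) — the multiplicative disjuncts; Thm. 16.2 (p. 269), §12.1 (p. 219)]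
[cite: Wuthrich2014, Thm. 3 and §1 (p. 383), §3 (pp. 388–390), §3.2 (p. 394), Lemma 11 (p. 394), Lemma 12 (p. 395), Lemma 14 (p. 396), Prop. 15 (p. 397), Thm. 16 (p. 397) and its proof (p. 398), Cor. 18 (p. 398), Cor. 19 and its proof (pp. 398–399), §4 (p. 396), §5 (p. 397)]
[cite: GreenbergLNM1716, Thm. 1.5 (PDF p. 61) and §5 (p. 143)]
[cite: MazurTateTeitelbaum1986Invent, §I.10, §I.13] -/
def kato_halfEigenCharIdeal_dvd_cyclotomicPrime_of_surjective : Prop :=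
  ∀ (p : ℕ) [Fact p.Prime] (V : WeierstrassCurve ℚ) [V.IsElliptic] [V.IsGloballyMinimal]
    (K : Type) [Field K] [NumberField K] [(galRange (K := ℚ) K).Normal]
    (F : Type) [Field F] [NumberField F] [IsCyclotomicExtension {p} ℚ F]
    [(galRange (K := ℚ) F).Normal]
    {κ : ZpExtension ℚ p} {γ : Field.absoluteGaloisGroup ℚ} {N : ℕ} [NeZero N]
    {f : CuspForm (Gamma0 N) 2} (B : PowerSeries ℚ_[p]),
    p ≠ 2 → Module.finrank ℚ K = 2 →
    (∃ θ : K, θ ^ 2 = algebraMap ℚ K ((-1) ^ (p / 2) * p)) →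
    ((IsOrdinaryAt V p ∧
        B = if Even (p / 2) then padicLFunctionBranch f ((unitRoot V p : ℤ_[p]) : ℚ_[p]) (p / 2)
          else padicLFunctionMinusBranch f ((unitRoot V p : ℤ_[p]) : ℚ_[p]) (p / 2)) ∨
      (V.HasSplitMultiplicativeReductionAtPrime p ∧
        B = if Even (p / 2) then padicLFunctionPlusBranchMult f (1 : ℚ_[p]) (p / 2)
          else padicLFunctionMinusBranchMult f (1 : ℚ_[p]) (p / 2)) ∨
      (V.HasMultiplicativeReductionAtPrime p ∧ ¬ V.HasSplitMultiplicativeReductionAtPrime p ∧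
        B = if Even (p / 2) then padicLFunctionPlusBranchMult f (-1 : ℚ_[p]) (p / 2)
          else padicLFunctionMinusBranchMult f (-1 : ℚ_[p]) (p / 2))) →
    (∀ n : ℕ, V.HasSurjectiveModNGaloisRep (p ^ n : ℕ)) →
    κ.IsCyclotomic → κ.IsTopGenerator γ → IsCyclotomicVariable p γ →
    γ ∈ galRange (K := ℚ) K → γ ∈ galRange (K := ℚ) F → IsNewformOf V f →
    ∀ (D : V.EigenSelmerDualData p
        (κ.kerSubgroup ⊓ galRange (K := ℚ) K ⊓ galRange (K := ℚ) F) κ.kerSubgroup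
        (fun g ↦ if g ∈ galRange (K := ℚ) K then 1 else -1) γ) (ϖ : ℚ),
      (if Even (p / 2) then (ϖ : ℝ) * V.realPeriodRat = plusPeriod f
        else (ϖ : ℝ) * V.imaginaryPeriodRat = minusPeriod f) →
      Module.IsTorsion (IwasawaAlgebra p) D.X ∧
      ∃ g ∈ D.charIdeal, ∃ u : ℤ_[p]ˣ,
        iwasawaToPowerSeries p g =
          PowerSeries.C (((u : ℤ_[p]) : ℚ_[p]) * (ϖ : ℚ_[p])) * B

end Literature.NumberTheory.EllipticCurves.Wuthrich2014

end
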